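import Literature.NumberTheory.QuadraticFields.RingClassGroup
import Literature.NumberTheory.QuadraticFields.RingClassOrder
import Mathlib.Data.ZMod.Basic
import Mathlib.Data.Nat.Totient
import HarnessLib

/-!
# The ring class group: `ker`/`range` of Cox's map `(𝓞 K/f)ˣ → I_K(f)/P_{K,ℤ}(f)` and the count
# `|I_K(f)/P_{K,ℤ}(f)| · |𝓞 Kˣ| · φ(f) = |(𝓞 K/f)ˣ| · |range (→ Cl(𝓞 K))| · |𝒪ˣ|` (Cox, §7.D)

Topic `NumberTheory/QuadraticFields`, namespace `Literature.NumberTheory.QuadraticFields.RingClass`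
(continuing `RingClassGroup.lean`). Everything here is PROVED (theorems only; no named facts).

For a quadratic field `K` with integral basis `(1, ω)`, `ω² = m + tω`, and `f` with `f𝓞 K ≠ 𝓞 K`:

* `toClassGroup_theta` — `theta` lands in `ker (I_K(f)/P_{K,ℤ}(f) → Cl(𝓞 K))`;
* `exists_theta_eq_of_toClassGroup_eq_one` — **exactness at `I_K(f) ∩ P_K`**: every element of the
  kernel is `[γ𝓞 K]` for some `γ` prime to `f` (Cox, (7.26)–(7.27): `(I_K(f) ∩ P_K)/P_{K,ℤ}(f)` is the
  image of `(𝓞 K/f)ˣ`);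
* `theta_eq_one_iff` — **`ker theta = (image of ℤ) · (image of 𝓞 Kˣ)`** (an `α𝓞 K ∈ P_{K,ℤ}(f)` forces
  `α = ε β`, `ε` a unit, `β ≡ b ∈ ℤ`);
* `card_ringClassGroup_mul` — the counting identity
  `|I_K(f)/P_{K,ℤ}(f)| · |𝓞 Kˣ| · φ(f) = |(𝓞 K/f𝓞 K)ˣ| · |range toClassGroup| · |U_f|`, where
  `U_f = {ε ∈ 𝓞 Kˣ : ε ≡ n (mod f), gcd(n, f) = 1}` (`= 𝒪ˣ` for the order `𝒪 = ℤ + f𝓞 K`), i.e. Cox's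
  (7.27) `h(𝒪)/h(𝒪_K) = |(𝓞 K/f)ˣ| / (|(ℤ/f)ˣ| · [𝓞 Kˣ : 𝒪ˣ])` once `toClassGroup` is onto
  (`RingClassForms.lean`).

## References

* D. A. Cox, *Primes of the form x² + ny²*, 2nd ed., Wiley (2013), §7.D, proof of Thm. 7.24,
  (7.25)–(7.27) and Exercises 7.29–7.30. [cite: Cox2013, §7.D Thm. 7.24]

## Mathlib / tree search

Mathlib: `ZMod.castHom`, `ZMod.castHom_injective`, `ZMod.card_units_eq_totient`, `MonoidHom.coprod`,
`Subgroup.card_mul_index`, `Subgroup.index_ker`, `Ideal.dvd_iff_le`, `Ideal.span_singleton_mul_right_inj`,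
`Ideal.span_singleton_eq_span_singleton`, `ClassGroup.mk0_eq_mk0_iff`, `ClassGroup.mk_mk0`.
Tree: `RingClassGroup`, `theta`, `theta_eq`, `prin*`, `exists_intCast_mem_of_sup_eq_top`.
-/

noncomputable section

open scoped nonZeroDivisors
open Module NumberField
open Literature.NumberTheory.QuadraticFields.Quadratic

namespace Literature.NumberTheory.QuadraticFields.RingClass

variable {K : Type*} [Field K] [NumberField K] {f : ℕ}
variable (b : Basis (Fin 2) ℤ (𝓞 K)) (hb : b 0 = 1) {t m : ℤ}
  (hω : b 1 * b 1 = (m : 𝓞 K) + (t : 𝓞 K) * b 1)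
variable (hf : Ideal.span {(f : 𝓞 K)} ≠ ⊤)

/-! ### `theta` maps into the kernel of `toClassGroup`, and onto it -/

include hb hω in
/-- `toClassGroup (theta x) = 1` (the ideal `α𝓞 K` is principal). [cite: Cox2013, §7.D (7.25)–(7.27)] -/
theorem toClassGroup_theta (x : (𝓞 K ⧸ Ideal.span {(f : 𝓞 K)})ˣ) :
    toClassGroup K f (theta K f b hb hω hf x) = 1 := by
  rw [theta_eq b hb hω hf (mk_liftU x), toClassGroup_mk, ClassGroup.mk_eq_one_iff,
    FractionalIdeal.isPrincipal_iff]
  exact ⟨((liftU x : 𝓞 K) : K), coe_prin _ (ne_zero_and_sup_eq_top_of_isUnit hf (isUnit_mk_liftU x)).1⟩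

/-- A generator of `I_K(f)` is `mk0` of its ideal. [cite: Cox2013, §7.C (definition of I_K(f))] -/
theorem eq_mk0_of_coe_eq {s : (FractionalIdeal (𝓞 K)⁰ K)ˣ} {𝔄 : Ideal (𝓞 K)}
    (hs : (s : FractionalIdeal (𝓞 K)⁰ K) = 𝔄) :
    ∃ h0 : 𝔄 ≠ ⊥, s = FractionalIdeal.mk0 K ⟨𝔄, mem_nonZeroDivisors_of_ne_bot h0⟩ := by
  have h0 : 𝔄 ≠ ⊥ := by
    intro h
    apply Units.ne_zero s
    rw [hs, h, FractionalIdeal.coeIdeal_bot]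
  exact ⟨h0, Units.ext (by rw [hs, FractionalIdeal.coe_mk0])⟩

omit [NumberField K] in
/-- An ideal prime to `f` times anything prime to `f` is prime to `f`. [cite: Cox2013, §7.C Lemma 7.18] -/
theorem mul_sup_eq_top {𝔄 𝔅 : Ideal (𝓞 K)} (h𝔄 : 𝔄 ⊔ Ideal.span {(f : 𝓞 K)} = ⊤)
    (h𝔅 : 𝔅 ⊔ Ideal.span {(f : 𝓞 K)} = ⊤) : 𝔄 * 𝔅 ⊔ Ideal.span {(f : 𝓞 K)} = ⊤ := by
  rw [sup_comm] at h𝔄 h𝔅 ⊢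
  rw [Ideal.sup_mul_eq_of_coprime_left h𝔄, h𝔅]

omit [NumberField K] in
/-- An element generating an ideal prime to `f` is invertible modulo `f`. [cite: Cox2013, §7.D (7.27)] -/
theorem isUnit_mk_of_sup_eq_top {γ : 𝓞 K} (h : Ideal.span {γ} ⊔ Ideal.span {(f : 𝓞 K)} = ⊤) :
    IsUnit (Ideal.Quotient.mk (Ideal.span {(f : 𝓞 K)}) γ) := by
  obtain ⟨r, hr, φ, hφ, h1⟩ := Submodule.mem_sup.1 (h ▸ Submodule.mem_top (x := (1 : 𝓞 K)))
  obtain ⟨r', rfl⟩ := Ideal.mem_span_singleton'.1 hr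
  refine IsUnit.of_mul_eq_one (Ideal.Quotient.mk _ r') ?_
  rw [← map_mul, ← (Ideal.Quotient.mk _).map_one, Ideal.Quotient.eq, mul_comm]
  have : r' * γ - 1 = -φ := by rw [← h1]; ring
  rw [this]
  exact Submodule.neg_mem _ hφ

include hb hω in
/-- **Exactness (Cox, (7.26)–(7.27))**: an element of `I_K(f)/P_{K,ℤ}(f)` dying in `Cl(𝓞 K)` is
`theta` of a unit: if `𝔄𝔅⁻¹` (`𝔄, 𝔅` prime to `f`) is principal, pick `n ∈ 𝔅 ∩ ℤ` prime to `f`,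
`(n) = 𝔅𝔅'`; then `[𝔄𝔅⁻¹] = [𝔄𝔅']` and `𝔄𝔅' = γ𝓞 K` with `γ` prime to `f`. [cite: Cox2013, §7.D (7.26)–(7.27)] -/
theorem exists_theta_eq_of_toClassGroup_eq_one {g : RingClassGroup K f} (hg : toClassGroup K f g = 1) :
    ∃ x, theta K f b hb hω hf x = g := by
  obtain ⟨u, rfl⟩ := QuotientGroup.mk_surjective g
  obtain ⟨s, ⟨𝔄, h𝔄, hs⟩, t', ⟨𝔅, h𝔅, ht⟩, hu⟩ := exists_eq_mul_inv_of_mem_ringClassNum u.2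
  obtain ⟨h𝔄0, rfl⟩ := eq_mk0_of_coe_eq hs
  obtain ⟨h𝔅0, rfl⟩ := eq_mk0_of_coe_eq ht
  -- `[𝔄] = [𝔅]` in `Cl(𝓞 K)`
  rw [toClassGroup_mk, hu, map_mul, map_inv, mul_inv_eq_one, ClassGroup.mk_mk0, ClassGroup.mk_mk0,
    ClassGroup.mk0_eq_mk0_iff] at hg
  obtain ⟨x, y, hx, hy, hxy⟩ := hg
  simp only at hxy
  -- an integer `n ∈ 𝔅` prime to `f`, and `(n) = 𝔅 𝔅'`
  obtain ⟨n, hn𝔅, hn⟩ := exists_intCast_mem_of_sup_eq_top b hb hω h𝔅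
  have hn0 : (n : 𝓞 K) ≠ 0 := by
    have := ne_zero_of_isCoprime hf hn
    exact_mod_cast this
  have hnle : Ideal.span {(n : 𝓞 K)} ≤ 𝔅 := (Ideal.span_singleton_le_iff_mem _).2 hn𝔅
  obtain ⟨𝔅', h𝔅𝔅'⟩ := Ideal.dvd_iff_le.2 hnle
  have hnf : Ideal.span {(n : 𝓞 K)} ⊔ Ideal.span {(f : 𝓞 K)} = ⊤ :=
    span_sup_eq_top_of_sub_mem hn (by rw [sub_self]; exact Submodule.zero_mem _)
  have h𝔅' : 𝔅' ⊔ Ideal.span {(f : 𝓞 K)} = ⊤ := by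
    refine top_le_iff.1 (hnf ▸ sup_le_sup_right ?_ _)
    exact Ideal.dvd_iff_le.1 ⟨𝔅, by rw [h𝔅𝔅', mul_comm]⟩
  have h𝔅'0 : 𝔅' ≠ ⊥ := by
    rintro rfl
    rw [Ideal.mul_bot] at h𝔅𝔅'
    exact hn0 (Ideal.span_singleton_eq_bot.1 h𝔅𝔅')
  -- `𝔄 𝔅' = (γ)`
  set J : Ideal (𝓞 K) := 𝔄 * 𝔅' with hJ
  have hJx : Ideal.span {x} * J = Ideal.span {y * (n : 𝓞 K)} := by
    rw [hJ, ← mul_assoc, hxy, mul_assoc, ← h𝔅𝔅', Ideal.span_singleton_mul_span_singleton]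
  have hyn : y * (n : 𝓞 K) ∈ Ideal.span {x} * J := by rw [hJx]; exact Ideal.mem_span_singleton_self _
  obtain ⟨γ, hγJ, hxγ⟩ := Ideal.mem_span_singleton_mul.1 hyn
  have hJγ : J = Ideal.span {γ} := by
    apply (Ideal.span_singleton_mul_right_inj hx).1
    rw [hJx, ← hxγ, Ideal.span_singleton_mul_span_singleton]
  have hJf : J ⊔ Ideal.span {(f : 𝓞 K)} = ⊤ := mul_sup_eq_top h𝔄 h𝔅'
  have hγ0 : γ ≠ 0 := by
    intro h
    rw [h, Ideal.span_singleton_zero, hJ, Ideal.mul_eq_bot] at hJγ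
    rcases hJγ with h' | h'
    · exact h𝔄0 h'
    · exact h𝔅'0 h'
  have hγf : Ideal.span {γ} ⊔ Ideal.span {(f : 𝓞 K)} = ⊤ := hJγ ▸ hJf
  have hγu : IsUnit (Ideal.Quotient.mk (Ideal.span {(f : 𝓞 K)}) γ) := isUnit_mk_of_sup_eq_top hγf
  refine ⟨hγu.unit, ?_⟩
  rw [theta_eq b hb hω hf (α := γ) (by simp), QuotientGroup.eq, Subgroup.mem_subgroupOf]
  show (prin K γ hγ0)⁻¹ * (u : (FractionalIdeal (𝓞 K)⁰ K)ˣ) ∈ ringClassDen K f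
  -- `(prin γ)⁻¹ · u = (prin n)⁻¹ ∈ P_{K,ℤ}(f)`
  have ht' : (FractionalIdeal.mk0 K ⟨𝔅, mem_nonZeroDivisors_of_ne_bot h𝔅0⟩) *
      FractionalIdeal.mk0 K ⟨𝔅', mem_nonZeroDivisors_of_ne_bot h𝔅'0⟩ = prin K (n : 𝓞 K) hn0 := by
    ext
    rw [Units.val_mul, FractionalIdeal.coe_mk0, FractionalIdeal.coe_mk0, coe_prin', h𝔅𝔅',
      FractionalIdeal.coeIdeal_mul]
  have hsJ : (FractionalIdeal.mk0 K ⟨𝔄, mem_nonZeroDivisors_of_ne_bot h𝔄0⟩) *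
      FractionalIdeal.mk0 K ⟨𝔅', mem_nonZeroDivisors_of_ne_bot h𝔅'0⟩ = prin K γ hγ0 := by
    ext
    rw [Units.val_mul, FractionalIdeal.coe_mk0, FractionalIdeal.coe_mk0, coe_prin', ← hJγ, hJ,
      FractionalIdeal.coeIdeal_mul]
  have htinv : (FractionalIdeal.mk0 K ⟨𝔅, mem_nonZeroDivisors_of_ne_bot h𝔅0⟩)⁻¹ =
      FractionalIdeal.mk0 K ⟨𝔅', mem_nonZeroDivisors_of_ne_bot h𝔅'0⟩ * (prin K (n : 𝓞 K) hn0)⁻¹ := by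
    rw [← ht', mul_inv_rev, mul_inv_cancel_left]
  rw [hu, htinv, ← mul_assoc (FractionalIdeal.mk0 K _), hsJ, inv_mul_cancel_left]
  exact Subgroup.inv_mem _ (prin_mem_ringClassDen hn0 hn (by rw [sub_self]; exact Submodule.zero_mem _))

/-! ### Integers modulo `f` inside `𝓞 K / f𝓞 K` -/

omit [NumberField K] in
include hb in
/-- `(n : 𝓞 K) ∈ f𝓞 K ↔ f ∣ n`. [cite: Cox2013, §7.A Lemma 7.2 (ℤ ∩ f𝒪_K = fℤ)] -/
theorem intCast_mem_span_iff (n : ℤ) : (n : 𝓞 K) ∈ Ideal.span {(f : 𝓞 K)} ↔ (f : ℤ) ∣ n := by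
  constructor
  · intro h
    have h0 := dvd_repr_of_mem_span b h 0
    have : b.repr (n : 𝓞 K) 0 = n := by
      have := repr_intCast_add_intCast_mul_zero b hb n 0
      simpa using this
    rwa [this] at h0
  · rintro ⟨k, rfl⟩
    push_cast
    exact Ideal.mul_mem_right _ _ (Ideal.mem_span_singleton_self _)

omit [NumberField K] in
include hb in
/-- `CharP (𝓞 K / f𝓞 K) f`. [cite: Cox2013, §7.A Lemma 7.2 (ℤ ∩ f𝒪_K = fℤ)] -/
theorem charP_quot : CharP (𝓞 K ⧸ Ideal.span {(f : 𝓞 K)}) f := by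
  refine ⟨fun x => ?_⟩
  rw [← map_natCast (Ideal.Quotient.mk (Ideal.span {(f : 𝓞 K)})), Ideal.Quotient.eq_zero_iff_mem]
  have : ((x : ℤ) : 𝓞 K) = (x : 𝓞 K) := by simp
  rw [← this, intCast_mem_span_iff b hb, Int.natCast_dvd_natCast]

omit [NumberField K] in
/-- An integer prime to `f` is a unit modulo `f`. [cite: Cox2013, §7.D (7.27)] -/
theorem isUnit_mk_intCast {a : ℤ} (ha : IsCoprime a (f : ℤ)) :
    IsUnit (Ideal.Quotient.mk (Ideal.span {(f : 𝓞 K)}) (a : 𝓞 K)) :=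
  isUnit_mk_of_sup_eq_top (span_sup_eq_top_of_sub_mem ha (by rw [sub_self]; exact Submodule.zero_mem _))

/-! ### The kernel of `theta` -/

include hb hω in
/-- **`ker theta`**: `theta x = 1` iff `x` is represented by `ε · a` with `ε ∈ 𝓞 Kˣ` and `a ∈ ℤ` prime to
`f` (if `α𝓞 K ∈ P_{K,ℤ}(f)` then `α β' = ε β` with `β ≡ b`, `β' ≡ b'` integers prime to `f`).
[cite: Cox2013, §7.D (7.27) and Exercise 7.30] -/
theorem theta_eq_one_iff (x : (𝓞 K ⧸ Ideal.span {(f : 𝓞 K)})ˣ) :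
    theta K f b hb hω hf x = 1 ↔
      ∃ ε : (𝓞 K)ˣ, ∃ a : ℤ, IsCoprime a (f : ℤ) ∧
        (x : 𝓞 K ⧸ Ideal.span {(f : 𝓞 K)}) = Ideal.Quotient.mk _ ((ε : 𝓞 K) * (a : 𝓞 K)) := by
  constructor
  · intro h
    rw [theta_eq b hb hω hf (mk_liftU x), QuotientGroup.eq_one_iff, Subgroup.mem_subgroupOf] at h
    have h' : prin K (liftU x) (ne_zero_and_sup_eq_top_of_isUnit hf (isUnit_mk_liftU x)).1 ∈
        ringClassDen K f := h
    obtain ⟨p, ⟨β, bβ, hbβ, hβ, hp⟩, q, ⟨β', b', hb', hβ', hq⟩, hpq⟩ := exists_eq_mul_inv_of_mem_ringClassDen h'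
    rw [eq_mul_inv_iff_mul_eq] at hpq
    have hval : ((Ideal.span {liftU x * β'} : Ideal (𝓞 K)) : FractionalIdeal (𝓞 K)⁰ K) =
        ((Ideal.span {β} : Ideal (𝓞 K)) : FractionalIdeal (𝓞 K)⁰ K) := by
      have := congrArg (fun u : (FractionalIdeal (𝓞 K)⁰ K)ˣ => (u : FractionalIdeal (𝓞 K)⁰ K)) hpq
      simp only [Units.val_mul, coe_prin, hq, hp, FractionalIdeal.spanSingleton_mul_spanSingleton] at this
      rw [FractionalIdeal.coeIdeal_span_singleton, FractionalIdeal.coeIdeal_span_singleton]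
      push_cast
      exact this
    obtain ⟨u, hu⟩ : Associated (liftU x * β') β :=
      Ideal.span_singleton_eq_span_singleton.1 (FractionalIdeal.coeIdeal_inj.1 hval)
    obtain ⟨c, d, hcd⟩ := hb'
    refine ⟨u⁻¹, bβ * c, hbβ.mul_left ⟨b', d, by linear_combination hcd⟩, ?_⟩
    set π := Ideal.Quotient.mk (Ideal.span {(f : 𝓞 K)}) with hπ
    have hcd' := congrArg (Int.cast : ℤ → 𝓞 K) hcd
    push_cast at hcd'
    have e1 : π β' * π (c : 𝓞 K) = 1 := by
      rw [← map_mul, ← π.map_one, Ideal.Quotient.eq]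
      have : β' * c - 1 = (β' - b') * c - d * (f : 𝓞 K) := by linear_combination hcd'
      rw [this]
      exact Submodule.sub_mem _ (Ideal.mul_mem_right _ _ hβ')
        (Ideal.mul_mem_left _ _ (Ideal.mem_span_singleton_self _))
    have e2 : π (liftU x) * π β' * π u = π β := by rw [← map_mul, ← map_mul, hu]
    have e3 : π β = π (bβ : 𝓞 K) := Ideal.Quotient.eq.2 hβ
    have e4 : π (u : 𝓞 K) * π ((u⁻¹ : (𝓞 K)ˣ) : 𝓞 K) = 1 := by rw [← map_mul, Units.mul_inv, map_one]
    calc (x : 𝓞 K ⧸ Ideal.span {(f : 𝓞 K)}) = π (liftU x) := (mk_liftU x).symm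
      _ = π (liftU x) * (π β' * π c) * (π u * π ((u⁻¹ : (𝓞 K)ˣ) : 𝓞 K)) := by rw [e1, e4, mul_one, mul_one]
      _ = (π (liftU x) * π β' * π u) * π ((u⁻¹ : (𝓞 K)ˣ) : 𝓞 K) * π c := by ring
      _ = π (((u⁻¹ : (𝓞 K)ˣ) : 𝓞 K) * ((bβ * c : ℤ) : 𝓞 K)) := by
        rw [e2, e3, ← map_mul, ← map_mul]
        congr 1
        push_cast
        ring
  · rintro ⟨ε, a, ha, hx⟩
    rw [theta_eq b hb hω hf (α := (ε : 𝓞 K) * (a : 𝓞 K)) hx.symm, QuotientGroup.eq_one_iff,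
      Subgroup.mem_subgroupOf]
    have ha0 : (a : 𝓞 K) ≠ 0 := by exact_mod_cast ne_zero_of_isCoprime hf ha
    show prin K ((ε : 𝓞 K) * (a : 𝓞 K)) (mul_ne_zero ε.ne_zero ha0) ∈ ringClassDen K f
    rw [prin_mul (ε : 𝓞 K) (a : 𝓞 K) ε.ne_zero ha0, prin_unit, one_mul]
    exact prin_mem_ringClassDen ha0 ha (by rw [sub_self]; exact Submodule.zero_mem _)

/-! ### The count -/

include hb hω in
/-- **`range theta = ker toClassGroup`** (exactness of
`(𝓞 K/f)ˣ → I_K(f)/P_{K,ℤ}(f) → Cl(𝓞 K)`). [cite: Cox2013, §7.D (7.25)–(7.27)] -/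
theorem range_theta_eq_ker : (theta K f b hb hω hf).range = (toClassGroup K f).ker := by
  ext g
  constructor
  · rintro ⟨x, rfl⟩
    exact toClassGroup_theta b hb hω hf x
  · intro hg
    exact exists_theta_eq_of_toClassGroup_eq_one b hb hω hf hg

/-- A unit of `ZMod f` from an integer prime to `f`. [cite: Cox2013, §7.D (7.27) ((ℤ/fℤ)ˣ)] -/
theorem exists_units_zmod_eq_intCast {a : ℤ} (ha : IsCoprime a (f : ℤ)) :
    ∃ au : (ZMod f)ˣ, (au : ZMod f) = a := by
  obtain ⟨u, v, huv⟩ := ha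
  have h : (a : ZMod f) * (u : ZMod f) = 1 := by
    have := congrArg (Int.cast : ℤ → ZMod f) huv
    push_cast at this
    rw [ZMod.natCast_self, mul_zero, add_zero] at this
    rw [mul_comm]; exact this
  exact ⟨Units.mkOfMulEqOne _ _ h, Units.val_mkOfMulEqOne h⟩

/-- The value of a unit of `ZMod f` is prime to `f`. [cite: Cox2013, §7.D (7.27) ((ℤ/fℤ)ˣ)] -/
theorem isCoprime_val_of_units [NeZero f] (a : (ZMod f)ˣ) : IsCoprime ((a : ZMod f).val : ℤ) (f : ℤ) := by
  rw [Nat.isCoprime_iff_coprime, ← ZMod.isUnit_iff_coprime, ZMod.natCast_zmod_val]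
  exact Units.isUnit a

include hb hω in
/-- **`|ker theta| · |𝒪ˣ| = |𝓞 Kˣ| · φ(f)`** where `𝒪ˣ = {ε ∈ 𝓞 Kˣ : ε ≡ n (mod f), gcd(n,f) = 1}` (the
units of the order `ℤ + f𝓞 K`): `ker theta` is the image of `𝓞 Kˣ × (ℤ/f)ˣ → (𝓞 K/f)ˣ`, whose kernel
projects bijectively onto `𝒪ˣ`. [cite: Cox2013, §7.D (7.27) and Exercise 7.30] -/
theorem card_ker_theta_mul (hf0 : f ≠ 0) :
    Nat.card (theta K f b hb hω hf).ker *
        Nat.card {ε : (𝓞 K)ˣ // ∃ n : ℤ, IsCoprime n (f : ℤ) ∧ (ε : 𝓞 K) - n ∈ Ideal.span {(f : 𝓞 K)}} =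
      Nat.card (𝓞 K)ˣ * Nat.totient f := by
  haveI : CharP (𝓞 K ⧸ Ideal.span {(f : 𝓞 K)}) f := charP_quot b hb
  haveI : NeZero f := ⟨hf0⟩
  set ψ : ZMod f →+* 𝓞 K ⧸ Ideal.span {(f : 𝓞 K)} := ZMod.castHom (dvd_refl f) _ with hψdef
  have hψ : Function.Injective ψ := ZMod.castHom_injective _
  have hψint : ∀ a : ℤ, ψ (a : ZMod f) = Ideal.Quotient.mk _ (a : 𝓞 K) := fun a => by
    rw [map_intCast, ← map_intCast (Ideal.Quotient.mk (Ideal.span {(f : 𝓞 K)}))]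
  set Ψ : (𝓞 K)ˣ × (ZMod f)ˣ →* (𝓞 K ⧸ Ideal.span {(f : 𝓞 K)})ˣ :=
    (Units.map (Ideal.Quotient.mk (Ideal.span {(f : 𝓞 K)}) : 𝓞 K →* _)).coprod (Units.map (ψ : ZMod f →* _))
    with hΨdef
  have hΨ : ∀ ε : (𝓞 K)ˣ, ∀ a : (ZMod f)ˣ,
      ((Ψ (ε, a) : (𝓞 K ⧸ Ideal.span {(f : 𝓞 K)})ˣ) : 𝓞 K ⧸ Ideal.span {(f : 𝓞 K)}) =
        Ideal.Quotient.mk _ (ε : 𝓞 K) * ψ (a : ZMod f) := fun ε a => by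
    rw [hΨdef, MonoidHom.coprod_apply, Units.val_mul, Units.coe_map, Units.coe_map]
    rfl
  -- `range Ψ = ker theta`
  have hrange : Ψ.range = (theta K f b hb hω hf).ker := by
    ext x
    rw [MonoidHom.mem_ker, theta_eq_one_iff b hb hω hf, MonoidHom.mem_range]
    constructor
    · rintro ⟨⟨ε, a⟩, rfl⟩
      refine ⟨ε, ((a : ZMod f).val : ℤ), isCoprime_val_of_units a, ?_⟩
      rw [hΨ, map_mul, ← hψint]
      push_cast
      rw [ZMod.natCast_zmod_val]
    · rintro ⟨ε, a, ha, hx⟩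
      obtain ⟨au, hau⟩ := exists_units_zmod_eq_intCast ha
      refine ⟨(ε, au), Units.ext ?_⟩
      rw [hΨ, hx, map_mul, hau, hψint]
  -- `ker Ψ ≃ 𝒪ˣ`
  have hkerU : ∀ p : (𝓞 K)ˣ × (ZMod f)ˣ, p ∈ Ψ.ker →
      ∃ n : ℤ, IsCoprime n (f : ℤ) ∧ ((p.1 : (𝓞 K)ˣ) : 𝓞 K) - n ∈ Ideal.span {(f : 𝓞 K)} := by
    rintro ⟨ε, a⟩ hp
    rw [MonoidHom.mem_ker] at hp
    have hval := congrArg (fun u : (𝓞 K ⧸ Ideal.span {(f : 𝓞 K)})ˣ => (u : 𝓞 K ⧸ Ideal.span {(f : 𝓞 K)})) hp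
    simp only [hΨ, Units.val_one] at hval
    refine ⟨(((a⁻¹ : (ZMod f)ˣ) : ZMod f).val : ℤ), isCoprime_val_of_units a⁻¹, ?_⟩
    have hinv : ψ (a : ZMod f) * ψ ((a⁻¹ : (ZMod f)ˣ) : ZMod f) = 1 := by
      rw [← map_mul, Units.mul_inv, map_one]
    have hε : Ideal.Quotient.mk _ (ε : 𝓞 K) = ψ ((a⁻¹ : (ZMod f)ˣ) : ZMod f) := by
      calc Ideal.Quotient.mk _ (ε : 𝓞 K)
          = Ideal.Quotient.mk _ (ε : 𝓞 K) * (ψ (a : ZMod f) * ψ ((a⁻¹ : (ZMod f)ˣ) : ZMod f)) := by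
            rw [hinv, mul_one]
        _ = (Ideal.Quotient.mk _ (ε : 𝓞 K) * ψ (a : ZMod f)) * ψ ((a⁻¹ : (ZMod f)ˣ) : ZMod f) := by ring
        _ = ψ ((a⁻¹ : (ZMod f)ˣ) : ZMod f) := by rw [hval, one_mul]
    rw [← Ideal.Quotient.eq, hε, ← hψint]
    push_cast
    rw [ZMod.natCast_zmod_val]
  let g : Ψ.ker → {ε : (𝓞 K)ˣ // ∃ n : ℤ, IsCoprime n (f : ℤ) ∧ (ε : 𝓞 K) - n ∈ Ideal.span {(f : 𝓞 K)}} :=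
    fun p => ⟨p.1.1, hkerU p.1 p.2⟩
  have hg : Function.Bijective g := by
    constructor
    · rintro ⟨⟨ε, a⟩, hp⟩ ⟨⟨ε', a'⟩, hp'⟩ hgg
      have hεε : ε = ε' := congrArg Subtype.val hgg
      subst hεε
      rw [MonoidHom.mem_ker] at hp hp'
      have hv := congrArg (fun u : (𝓞 K ⧸ Ideal.span {(f : 𝓞 K)})ˣ => (u : 𝓞 K ⧸ Ideal.span {(f : 𝓞 K)})) hp
      have hv' := congrArg (fun u : (𝓞 K ⧸ Ideal.span {(f : 𝓞 K)})ˣ => (u : 𝓞 K ⧸ Ideal.span {(f : 𝓞 K)})) hp'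
      simp only [hΨ, Units.val_one] at hv hv'
      have haa : ψ (a : ZMod f) = ψ (a' : ZMod f) := by
        calc ψ (a : ZMod f) = ψ (a : ZMod f) * (Ideal.Quotient.mk _ (ε : 𝓞 K) * ψ (a' : ZMod f)) := by
              rw [hv', mul_one]
          _ = (Ideal.Quotient.mk _ (ε : 𝓞 K) * ψ (a : ZMod f)) * ψ (a' : ZMod f) := by ring
          _ = ψ (a' : ZMod f) := by rw [hv, one_mul]
      have : a = a' := Units.ext (hψ haa)
      subst this
      rfl
    · rintro ⟨ε, n, hn, hε⟩
      obtain ⟨au, hau⟩ := exists_units_zmod_eq_intCast hn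
      refine ⟨⟨(ε, au⁻¹), ?_⟩, rfl⟩
      rw [MonoidHom.mem_ker]
      apply Units.ext
      rw [hΨ, Units.val_one, Ideal.Quotient.eq.2 hε, ← hψint, ← hau, ← map_mul, Units.mul_inv, map_one]
  have hker : Nat.card Ψ.ker =
      Nat.card {ε : (𝓞 K)ˣ // ∃ n : ℤ, IsCoprime n (f : ℤ) ∧ (ε : 𝓞 K) - n ∈ Ideal.span {(f : 𝓞 K)}} :=
    Nat.card_eq_of_bijective g hg
  rw [← hrange, ← hker, ← Subgroup.index_ker, mul_comm, Subgroup.card_mul_index, Nat.card_prod,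
    Nat.card_eq_fintype_card (α := (ZMod f)ˣ), ZMod.card_units_eq_totient]

include hb hω hf in
/-- **The counting identity of Cox's Thm. 7.24** (before identifying `I_K(f)/P_{K,ℤ}(f)` with the form
class group and before proving the surjectivity onto `Cl(𝓞 K)`):
`|I_K(f)/P_{K,ℤ}(f)| · |𝓞 Kˣ| · φ(f) = |(𝓞 K/f𝓞 K)ˣ| · |range(→ Cl(𝓞 K))| · |𝒪ˣ|`.
[cite: Cox2013, §7.D Thm. 7.24 (proof, (7.25)–(7.27))] -/
theorem card_ringClassGroup_mul (hf0 : f ≠ 0) :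
    Nat.card (RingClassGroup K f) * Nat.card (𝓞 K)ˣ * Nat.totient f =
      Nat.card (𝓞 K ⧸ Ideal.span {(f : 𝓞 K)})ˣ * Nat.card (toClassGroup K f).range *
        Nat.card {ε : (𝓞 K)ˣ // ∃ n : ℤ, IsCoprime n (f : ℤ) ∧ (ε : 𝓞 K) - n ∈ Ideal.span {(f : 𝓞 K)}} := by
  have h1 : Nat.card (RingClassGroup K f) =
      Nat.card (toClassGroup K f).ker * Nat.card (toClassGroup K f).range := by
    rw [← Subgroup.index_ker, Subgroup.card_mul_index]
  have h2 : Nat.card (𝓞 K ⧸ Ideal.span {(f : 𝓞 K)})ˣ =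
      Nat.card (theta K f b hb hω hf).ker * Nat.card (theta K f b hb hω hf).range := by
    rw [← Subgroup.index_ker, Subgroup.card_mul_index]
  have h3 : Nat.card (theta K f b hb hω hf).range = Nat.card (toClassGroup K f).ker := by
    rw [range_theta_eq_ker]
  have h4 := card_ker_theta_mul b hb hω hf hf0
  calc Nat.card (RingClassGroup K f) * Nat.card (𝓞 K)ˣ * Nat.totient f
      = Nat.card (toClassGroup K f).ker * Nat.card (toClassGroup K f).range *
          (Nat.card (𝓞 K)ˣ * Nat.totient f) := by rw [h1]; ring
    _ = Nat.card (toClassGroup K f).ker * Nat.card (toClassGroup K f).range *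
          (Nat.card (theta K f b hb hω hf).ker *
            Nat.card {ε : (𝓞 K)ˣ // ∃ n : ℤ, IsCoprime n (f : ℤ) ∧ (ε : 𝓞 K) - n ∈ Ideal.span {(f : 𝓞 K)}}) := by
        rw [h4]
    _ = Nat.card (theta K f b hb hω hf).ker * Nat.card (theta K f b hb hω hf).range *
          Nat.card (toClassGroup K f).range *
            Nat.card {ε : (𝓞 K)ˣ // ∃ n : ℤ, IsCoprime n (f : ℤ) ∧ (ε : 𝓞 K) - n ∈ Ideal.span {(f : 𝓞 K)}} := by
        rw [h3]; ring
    _ = _ := by rw [← h2]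


/-! ### Finiteness of the ring class group of a quadratic field -/

section Finite

variable {K : Type*} [Field K] [NumberField K] {f : ℕ}

/-- **The ring class group `I_K(1)/P_{K,ℤ}(1)` embeds into `Cl(𝓞 K)`**: for `f = 1` the subgroup
`P_{K,ℤ}(1)` contains every principal ideal `α𝓞 K` (`α ≡ 1 mod 𝓞 K` is no condition), so an element
of `I_K(1)` whose image in `Cl(𝓞 K)` is trivial — a principal fractional ideal `(α/β)`, `α, β ∈ 𝓞 K`
— lies in `P_{K,ℤ}(1)`. (Cox, §7.C: for `f = 1`, `I_K(1)/P_{K,ℤ}(1) = I_K/P_K = C(𝒪_K)`.)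
[cite: Cox2013, §7.C Prop. 7.22 (case f = 1) and §7.A Thm. 7.7] -/
theorem toClassGroup_injective_one : Function.Injective (toClassGroup K 1) := by
  rw [injective_iff_map_eq_one]
  intro g hg
  obtain ⟨u, rfl⟩ := QuotientGroup.mk_surjective g
  rw [toClassGroup_mk, ClassGroup.mk_eq_one_iff] at hg
  rw [QuotientGroup.eq_one_iff, Subgroup.mem_subgroupOf]
  -- `u = (x)` with `x = α / β`, `α, β ∈ 𝓞 K` nonzero
  obtain ⟨x, hx⟩ := hg
  have hux : ((u : (FractionalIdeal (𝓞 K)⁰ K)ˣ) : FractionalIdeal (𝓞 K)⁰ K) =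
      FractionalIdeal.spanSingleton (𝓞 K)⁰ x := by
    apply FractionalIdeal.coeToSubmodule_injective
    simp only [FractionalIdeal.coe_spanSingleton]
    exact hx
  have hx0 : x ≠ 0 := by
    intro h0
    rw [h0, FractionalIdeal.spanSingleton_zero] at hux
    exact Units.ne_zero _ hux
  obtain ⟨α, β, hβ, hxe⟩ := IsFractionRing.div_surjective (A := 𝓞 K) x
  have hβ0 : (β : 𝓞 K) ≠ 0 := nonZeroDivisors.ne_zero hβ
  have hα0 : α ≠ 0 := by
    rintro rfl
    apply hx0
    rw [← hxe, map_zero, zero_div]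
  -- `(x) = (α)(β)⁻¹` with `(α), (β) ∈ P_{K,ℤ}(1)`
  have hmem : ∀ {γ : 𝓞 K} (hγ : γ ≠ 0), prin K γ hγ ∈ ringClassDen K 1 := fun {γ} hγ =>
    prin_mem_ringClassDen hγ (a := 1) isCoprime_one_right (by
      rw [Nat.cast_one, Ideal.span_singleton_one]; exact Submodule.mem_top)
  have hu : (u : (FractionalIdeal (𝓞 K)⁰ K)ˣ) = prin K α hα0 * (prin K β hβ0)⁻¹ := by
    rw [eq_mul_inv_iff_mul_eq]
    apply Units.ext
    rw [Units.val_mul, hux, coe_prin, coe_prin, FractionalIdeal.spanSingleton_mul_spanSingleton, ← hxe,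
      div_mul_cancel₀ _ (by exact_mod_cast hβ0 : ((β : 𝓞 K) : K) ≠ 0)]
  rw [hu]
  exact Subgroup.mul_mem _ (hmem hα0) (Subgroup.inv_mem _ (hmem hβ0))

/-- **The ring class group `I_K(f)/P_{K,ℤ}(f)` of a quadratic field is finite** (`f ≥ 1`).  For
`f = 1` it embeds into the finite `Cl(𝓞 K)` (`toClassGroup_injective_one`); for `f ≥ 2` the kernel
of `I_K(f)/P_{K,ℤ}(f) → Cl(𝓞 K)` is the image of the finite group `(𝓞 K/f𝓞 K)ˣ` under Cox's `theta`
(`range_theta_eq_ker`, exactness (7.25)–(7.27)) and the image is a subgroup of `Cl(𝓞 K)`, so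
`|I_K(f)/P_{K,ℤ}(f)| = |ker| · |range|` is a product of nonzero finite cardinalities (Cox, Thm. 7.24:
`h(𝒪)` is finite, indeed `= h(𝒪_K) f / [𝒪_Kˣ : 𝒪ˣ] · ∏_{p ∣ f} (1 − (d_K/p)/p)`).
[cite: Cox2013, §7.D Thm. 7.24 with (7.25)–(7.27)] -/
theorem finite_ringClassGroup (h2 : finrank ℚ K = 2) (hf0 : f ≠ 0) : Finite (RingClassGroup K f) := by
  classical
  by_cases hf1 : f = 1
  · subst hf1
    exact Finite.of_injective _ toClassGroup_injective_one
  -- `f ≥ 2`: an integral basis `(1, ω)` and `f𝓞 K ≠ 𝓞 K`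
  obtain ⟨b, hb⟩ := exists_basis_zero_eq_one (K := K) h2
  have hω := basis_one_mul_self_eq b hb
  have hf : Ideal.span {(f : 𝓞 K)} ≠ ⊤ := by
    intro htop
    have h1 : ((1 : ℤ) : 𝓞 K) ∈ Ideal.span {(f : 𝓞 K)} := by rw [htop]; exact Submodule.mem_top
    rw [intCast_mem_span_iff b hb] at h1
    have : (f : ℤ) ≤ 1 := Int.le_of_dvd one_pos h1
    omega
  -- the kernel of `toClassGroup` is the (finite) range of `theta`
  haveI : Finite (𝓞 K ⧸ Ideal.span {(f : 𝓞 K)}) :=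
    Ideal.finiteQuotientOfFreeOfNeBot _ (by
      rw [Ne, Ideal.span_singleton_eq_bot]; exact_mod_cast hf0)
  have hker : Finite (toClassGroup K f).ker := by
    rw [← range_theta_eq_ker b hb hω hf]
    exact (Set.finite_range _).to_subtype
  have hrange : Finite (toClassGroup K f).range := inferInstance
  have hk0 : Nat.card (toClassGroup K f).ker ≠ 0 := by
    haveI := hker
    exact Nat.card_pos.ne'
  have hr0 : Nat.card (toClassGroup K f).range ≠ 0 := by
    haveI := hrange
    exact Nat.card_pos.ne'
  have h := Subgroup.card_mul_index (toClassGroup K f).ker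
  rw [Subgroup.index_ker] at h
  exact Nat.finite_of_card_ne_zero (by rw [← h]; exact mul_ne_zero hk0 hr0)

end Finite

end Literature.NumberTheory.QuadraticFields.RingClass
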